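import Literature.Geometry.Lorentzian.CoordVolumeForm
import Literature.Geometry.Lorentzian.CoordDivergenceIdentity
import Literature.Analysis.Distribution.FieldIntegrationByParts
import HarnessLib

/-!
# The divergence theorem in coordinates: `∫ √det g · div_G B dy = 0` for compactly supported `B`

Everything here is PROVED; no definition and no statement of `Prop` type is introduced.

For metric components `G` on an open set `V` of a finite-dimensional space `E` (coordinate
tensor calculus `MetricCoord.IsMetricOn`, `CoordCurvature.lean` ff.), RIEMANNIAN on `V`, a basis
`b` and the volume density `sqrtDetGram G b = √det(G(b_i,b_k))` (`CoordVolumeForm.lean`):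

* `divAt_eq_sum_coord` — the divergence of a vector field in the basis,
  `div_G B = Σ_i bⁱ(DB(x) b_i) + Σ_j bʲ(B x) Σ_m Γ^m_{jm}` (O'Neill 1983, Ch. 3, p. 86 with
  Prop. 3.13);
* `IsMetricOn.sqrtDetGram_mul_divAt_eq_sum_fderiv` — **`√det g · div_G B = Σ_j ∂_{b_j}(√det g · Bʲ)`**
  (the classical `div B = (1/√g) ∂_j(√g Bʲ)`, from Jacobi's formula
  `∂_j √det g = √det g Σ_m Γ^m_{jm}`, `IsMetricOn.fderiv_sqrtDetGram`; O'Neill 1983, Ch. 7,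
  Lemma 7.19 ff., Lee 2018, Prop. 2.46);
* (`∫ ∂_v f dμ = 0` for a compactly supported `C¹` function and an additive Haar measure `μ` is
  `Literature.Analysis.Distribution.integral_fderiv_apply_eq_zero`, `FieldIntegrationByParts.lean`);
* **`IsMetricOn.integral_sqrtDetGram_mul_divAt_eq_zero`** — for a vector field `B` smooth on `V`
  with compact support contained in `V`: `∫_E √det g · div_G B dμ = 0` — the divergence theorem
  `∫ div_G B dvol_G = 0` written in one chart (Lee 2018, Thm. 16.32 / Prop. 16.33 with empty
  boundary; the integrand vanishes identically off the support);
* `IsMetricOn.integral_sqrtDetGram_mul_eq_of_eq_add_divAt` — the bookkeeping form used for Green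
  identities: if `f = h + div_G B` on `V` with such a `B` and `f`, `h` vanish off `V`, then
  `∫ √det g · f = ∫ √det g · h`.

Purpose: the integration step of the cokernel projections `𝓘_α` in the Corvino–Schoen scheme of
Li–Mei 2020, Prop. 4.1 (arXiv:2005.01249, p. 23: `∫ ⟨DΦ(δ), ξ⟩ = ∫ ⟨δ, DΦ*ξ⟩ + boundary terms`),
where the pointwise Green identity is `MetricCoord.IsMetricOn.linConstraint_pairing_eq`
(`CoordConstraintAdjoint.lean`) and the boundary terms are made to vanish by a compactly supported
cut-off.

## References

* B. O'Neill, *Semi-Riemannian geometry with applications to relativity*, 1983, Ch. 3, p. 86,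
  Prop. 3.13; Ch. 7, Def. 7.18–Lemma 7.19 and Lemma 7.21 (divergence theorem). [ONeill1983]
* J. M. Lee, *Introduction to Riemannian Manifolds*, 2nd ed., 2018, Prop. 2.46 (`div` in
  coordinates). [Lee2018]
* J. Li, H. Mei, Comm. Math. Phys. 378 (2020), arXiv:2005.01249, §4, p. 23. [LiMei2020]
-/

noncomputable section

open Set Filter Module Function MeasureTheory
open scoped Topology ContDiff

namespace Literature.Geometry.Lorentzian

namespace MetricCoord

variable {E : Type*} [NormedAddCommGroup E] [NormedSpace ℝ E] {ι : Type*} [Fintype ι]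
  [DecidableEq ι] {G : E → E →L[ℝ] E →L[ℝ] ℝ} (b : Basis ι ℝ E) {V : Set E} {x : E}

/-! ### The divergence in a basis and the density identity -/

section Pointwise

variable [FiniteDimensional ℝ E]

omit [DecidableEq ι] in
/-- **The divergence of a vector field in a basis**:
`div_G B (x) = Σ_i bⁱ(DB(x) b_i) + Σ_j bʲ(B x) · Σ_m Γ^m_{jm}(x)` (`div = tr ∇B`,
`∇_X B = DB X + Γ(B, X)`; O'Neill 1983, Ch. 3, p. 86). [cite: ONeill1983, Ch. 3, p. 86] -/
theorem divAt_eq_sum_coord (B : E → E) (x : E) :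
    divAt G B x = ∑ i, b.coord i (fderiv ℝ B x (b i)) +
      ∑ j, b.coord j (B x) * ∑ m, chrCoef G b x j m m := by
  rw [divAt_eq, traceCLM_apply, trace_eq_sum_coord b]
  simp only [ContinuousLinearMap.coe_coe, covDAt_apply, map_add, Finset.sum_add_distrib]
  congr 1
  -- expand `B x` in the basis in the Christoffel term
  have hB : ∀ i, chrAt G x (B x) (b i) = ∑ j, b.coord j (B x) • chrAt G x (b j) (b i) := by
    intro i
    conv_lhs => rw [← b.sum_repr (B x)]
    rw [map_sum, FunLike.coe_sum, Finset.sum_apply]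
    refine Finset.sum_congr rfl fun j _ ↦ ?_
    rw [map_smul, _root_.smul_apply, Basis.coord_apply]
  simp_rw [hB, map_sum, map_smul, smul_eq_mul]
  rw [Finset.sum_comm]
  refine Finset.sum_congr rfl fun j _ ↦ ?_
  rw [Finset.mul_sum]
  refine Finset.sum_congr rfl fun m _ ↦ ?_
  rw [chrCoef]

/-- **`√det g · div_G B = Σ_j ∂_{b_j}(√det g · Bʲ)`** at a point of `V` where `G` is positive
definite, for `B` differentiable there (`∂_j √det g = √det g Σ_m Γ^m_{jm}`,
`IsMetricOn.fderiv_sqrtDetGram`). Lee 2018, Prop. 2.46. [cite: ONeill1983, Ch. 7, Lemma 7.19] -/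
theorem IsMetricOn.sqrtDetGram_mul_divAt_eq_sum_fderiv [CompleteSpace E] (hG : IsMetricOn G V)
    (hx : x ∈ V) (hpos : ∀ v : E, v ≠ 0 → 0 < G x v v) {B : E → E} (hB : DifferentiableAt ℝ B x) :
    sqrtDetGram G b x * divAt G B x =
      ∑ j, fderiv ℝ (fun y ↦ sqrtDetGram G b y * b.coord j (B y)) x (b j) := by
  have hdet : 0 < (Matrix.of fun i k ↦ G x (b i) (b k)).det :=
    det_gramMatrix_pos b (hG.symm x hx) hpos
  have hsd : DifferentiableAt ℝ (sqrtDetGram G b) x :=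
    (Literature.Analysis.Calculus.hasFDerivAt_sqrt_det (hG.hasFDerivAt_gramRows b hx)
      hdet).differentiableAt
  have hcd : ∀ j, DifferentiableAt ℝ (fun y ↦ b.coord j (B y)) x := fun j ↦
    (LinearMap.toContinuousLinearMap (b.coord j)).differentiableAt.comp x hB
  have hcf : ∀ j, fderiv ℝ (fun y ↦ b.coord j (B y)) x (b j) = b.coord j (fderiv ℝ B x (b j)) := by
    intro j
    have h := (LinearMap.toContinuousLinearMap (b.coord j)).hasFDerivAt.comp x hB.hasFDerivAt
    rw [show (fun y ↦ b.coord j (B y)) = (LinearMap.toContinuousLinearMap (b.coord j)) ∘ B from rfl,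
      h.fderiv]
    rfl
  have hterm : ∀ j, fderiv ℝ (fun y ↦ sqrtDetGram G b y * b.coord j (B y)) x (b j) =
      sqrtDetGram G b x * (∑ m, chrCoef G b x j m m) * b.coord j (B x) +
        sqrtDetGram G b x * b.coord j (fderiv ℝ B x (b j)) := by
    intro j
    rw [fderiv_fun_mul hsd (hcd j), _root_.add_apply, _root_.smul_apply, _root_.smul_apply,
      smul_eq_mul, smul_eq_mul, hG.fderiv_sqrtDetGram b hx hpos j, hcf j]
    ring
  simp_rw [hterm]
  rw [Finset.sum_add_distrib, divAt_eq_sum_coord b, mul_add, Finset.mul_sum, Finset.mul_sum,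
    add_comm]
  congr 1
  exact Finset.sum_congr rfl fun j _ ↦ by ring

omit [Fintype ι] [DecidableEq ι] [FiniteDimensional ℝ E] in
/-- The divergence of a field vanishing near `x` vanishes at `x`. [folklore] -/
theorem divAt_eq_zero_of_eventuallyEq_zero [FiniteDimensional ℝ E] {B : E → E}
    (hB : B =ᶠ[𝓝 x] fun _ ↦ 0) : divAt G B x = 0 := by
  rw [divAt_eq, covDAt, hB.fderiv_eq, fderiv_fun_const, hB.self_of_nhds, map_zero]
  simp

end Pointwise

/-! ### Integration -/

section Integral

variable [FiniteDimensional ℝ E] [MeasurableSpace E] [BorelSpace E] (μ : Measure E)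
  [μ.IsAddHaarMeasure]

/-- **The divergence theorem in coordinates**: for metric components `G` positive definite on
`V` and a vector field `B` smooth on `V` whose (topological) support is a compact subset of `V`,
`∫ √det g · div_G B dμ = 0` — `∫_V div_G B dvol_G = 0` in one chart; the integrand vanishes
identically off the support. O'Neill 1983, Ch. 7, Lemma 7.21; Lee 2018, Thm. 16.32.
[cite: ONeill1983, Ch. 7, Lemma 7.21] -/
theorem IsMetricOn.integral_sqrtDetGram_mul_divAt_eq_zero [CompleteSpace E] (hG : IsMetricOn G V)
    (hpos : ∀ y ∈ V, ∀ v : E, v ≠ 0 → 0 < G y v v) {B : E → E} (hB : ContDiffOn ℝ ∞ B V)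
    (hsupp : HasCompactSupport B) (hBV : tsupport B ⊆ V) :
    ∫ x, sqrtDetGram G b x * divAt G B x ∂μ = 0 := by
  -- the coordinate fluxes `F_j = √det g · Bʲ`
  set F : ι → E → ℝ := fun j y ↦ sqrtDetGram G b y * b.coord j (B y) with hF
  -- off the support everything vanishes near the point
  have hzero : ∀ x ∉ tsupport B, B =ᶠ[𝓝 x] fun _ ↦ 0 := fun x hx ↦
    notMem_tsupport_iff_eventuallyEq.mp hx
  have hFzero : ∀ j, ∀ x ∉ tsupport B, F j =ᶠ[𝓝 x] fun _ ↦ 0 := fun j x hx ↦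
    (hzero x hx).mono fun y hy ↦ by simp [hF, hy]
  -- `F_j` is `C¹` everywhere
  have hFdiff : ∀ j, ContDiff ℝ 1 (F j) := by
    intro j
    rw [contDiff_iff_contDiffAt]
    intro x
    by_cases hx : x ∈ tsupport B
    · have hxV := hBV hx
      have hsg : ContDiffAt ℝ 1 (sqrtDetGram G b) x :=
        ((hG.contDiffOn_sqrtDetGram b hpos).of_le (by simp)).contDiffAt (hG.mem_nhds hxV)
      have hBx : ContDiffAt ℝ 1 B x := ((hB.of_le (by simp)) x hxV).contDiffAt (hG.mem_nhds hxV)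
      exact hsg.mul ((LinearMap.toContinuousLinearMap (b.coord j)).contDiff.contDiffAt.comp x hBx)
    · exact (contDiffAt_const (c := (0 : ℝ))).congr_of_eventuallyEq (hFzero j x hx)
  have hFsupp : ∀ j, HasCompactSupport (F j) := fun j ↦
    hsupp.mono' fun x hx ↦ by
      by_contra hxB
      exact hx ((hFzero j x hxB).self_of_nhds)
  -- the integrand is the sum of the coordinate derivatives of the fluxes, everywhere
  have hpt : ∀ x, sqrtDetGram G b x * divAt G B x = ∑ j, fderiv ℝ (F j) x (b j) := by
    intro x
    by_cases hx : x ∈ tsupport B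
    · have hxV := hBV hx
      exact hG.sqrtDetGram_mul_divAt_eq_sum_fderiv b hxV (hpos x hxV)
        (((hB x hxV).contDiffAt (hG.mem_nhds hxV)).differentiableAt (by simp))
    · rw [divAt_eq_zero_of_eventuallyEq_zero (hzero x hx), mul_zero]
      symm
      refine Finset.sum_eq_zero fun j _ ↦ ?_
      rw [(hFzero j x hx).fderiv_eq, fderiv_fun_const]
      rfl
  simp_rw [hpt]
  rw [integral_finsetSum _ fun j _ ↦ ?_]
  · exact Finset.sum_eq_zero fun j _ ↦
      Literature.Analysis.Distribution.integral_fderiv_apply_eq_zero (μ := μ) (hFdiff j) (hFsupp j) (b j)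
  · exact (((hFdiff j).continuous_fderiv one_ne_zero).clm_apply continuous_const).integrable_of_hasCompactSupport
      (((hFsupp j).fderiv (𝕜 := ℝ)).mono' fun x hx ↦ by
        refine subset_tsupport _ ?_
        intro h0
        exact hx (by simp [h0]))

/-- **Green-identity bookkeeping**: if `f = h + div_G B` on `V` for a vector field `B` smooth on
`V` with compact support inside `V`, and `f`, `h` vanish off `V`, then `∫ √det g · f = ∫ √det g · h`
(provided `√det g · h` is integrable). This is the form in which the pointwise Green identities of
the coordinate calculus (`mul_linScalAt_sub_pairAt_adjScalAt`, `linConstraint_pairing_eq`) are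
integrated. [cite: ONeill1983, Ch. 7, Lemma 7.21] -/
theorem IsMetricOn.integral_sqrtDetGram_mul_eq_of_eq_add_divAt [CompleteSpace E]
    (hG : IsMetricOn G V) (hpos : ∀ y ∈ V, ∀ v : E, v ≠ 0 → 0 < G y v v) {B : E → E}
    (hB : ContDiffOn ℝ ∞ B V) (hsupp : HasCompactSupport B) (hBV : tsupport B ⊆ V)
    {f h : E → ℝ} (hfh : ∀ x ∈ V, f x = h x + divAt G B x) (hf : ∀ x ∉ V, f x = 0)
    (hh : ∀ x ∉ V, h x = 0) (hhi : Integrable (fun x ↦ sqrtDetGram G b x * h x) μ) :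
    ∫ x, sqrtDetGram G b x * f x ∂μ = ∫ x, sqrtDetGram G b x * h x ∂μ := by
  have hdiv0 : ∀ x ∉ V, divAt G B x = 0 := fun x hx ↦
    divAt_eq_zero_of_eventuallyEq_zero
      (notMem_tsupport_iff_eventuallyEq.mp fun h' ↦ hx (hBV h'))
  have hpt : ∀ x, sqrtDetGram G b x * f x =
      sqrtDetGram G b x * h x + sqrtDetGram G b x * divAt G B x := by
    intro x
    by_cases hx : x ∈ V
    · rw [hfh x hx, mul_add]
    · rw [hf x hx, hh x hx, hdiv0 x hx, mul_zero, add_zero]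
  simp_rw [hpt]
  have hdi : Integrable (fun x ↦ sqrtDetGram G b x * divAt G B x) μ := by
    -- the function is continuous with compact support contained in `tsupport B`
    have hcont : Continuous fun x ↦ sqrtDetGram G b x * divAt G B x := by
      rw [continuous_iff_continuousAt]
      intro x
      by_cases hx : x ∈ tsupport B
      · have hxV := hBV hx
        have h1 : ContinuousAt (sqrtDetGram G b) x :=
          ((hG.contDiffOn_sqrtDetGram b hpos).continuousOn.continuousWithinAt hxV).continuousAt
            (hG.mem_nhds hxV)
        have h2 : ContinuousAt (fun y ↦ divAt G B y) x := by
          exact (hG.hasFDerivAt_divAt hxV hB).continuousAt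
        exact h1.mul h2
      · have h0 : (fun y ↦ sqrtDetGram G b y * divAt G B y) =ᶠ[𝓝 x] fun _ ↦ 0 := by
          have hxB : B =ᶠ[𝓝 x] fun _ ↦ 0 := notMem_tsupport_iff_eventuallyEq.mp hx
          -- `B` vanishes on a neighbourhood, hence so does `div B` on a (smaller) neighbourhood
          obtain ⟨U, hU, hUo, hxU⟩ := mem_nhds_iff.1 hxB
          filter_upwards [hUo.mem_nhds hxU] with y hy
          have hyB : B =ᶠ[𝓝 y] fun _ ↦ 0 :=
            Filter.eventually_of_mem (hUo.mem_nhds hy) fun z hz ↦ hU hz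
          rw [divAt_eq_zero_of_eventuallyEq_zero hyB, mul_zero]
        exact (continuousAt_const.congr_of_eventuallyEq h0 :)
    refine hcont.integrable_of_hasCompactSupport (hsupp.mono' fun x hx ↦ ?_)
    by_contra hxB
    have hxB' : B =ᶠ[𝓝 x] fun _ ↦ 0 := notMem_tsupport_iff_eventuallyEq.mp hxB
    exact hx (by simp [divAt_eq_zero_of_eventuallyEq_zero hxB'])
  rw [integral_add hhi hdi, hG.integral_sqrtDetGram_mul_divAt_eq_zero b μ hpos hB hsupp hBV, add_zero]

end Integral

end MetricCoord

end Literature.Geometry.Lorentzian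

end
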